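import Literature.Computability.MetaComplexity.MCSPProofs
import Literature.Computability.Complexity.SearchToDecision
import Literature.Computability.Complexity.EquivalenceProblemsUPSubsetRPProofs
import Literature.Computability.Complexity.PRelHierarchy
import HarnessLib

/-!
# Route UniformStream, crux `UniformMagnification` (stmt-PneNP-16047), line `registered`,
# stub `stub_searchStream`, part A: the consistency relation and its search function

McKay–Murray–Williams' Algorithm 1 (block length `1`) keeps, after a prefix `p` of a truth table
of arity `n`, a certificate `D` (a good program of the circuit-evaluation machine `CircEval`,
see `stub_goodProg`) of a circuit of size `≤ t` whose truth table extends `p`; on the next bit `b`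
it asks for a good program `D'` that agrees with `D` on all rows `< |p|` and answers `b` on row
`|p|`. This file builds that request as a language of pairs `⟨q, D'⟩` over `{0,1}` and, UNDER
`NP ⊆ P`, puts it in `P` and extracts a polynomial-time search function for it (Arora–Barak,
Thm. 2.18, `exists_searchFn_of_NP_subset_P`). No oracle machine and no Turing machine is
programmed: everything is assembled in the tree's `FP`/`P` algebra.

* Queries are `q = ⟨body, cb⟩` with `body = ⟨uv, ⟨Pw, Df⟩⟩`, `uv = ⟨u, v⟩` (`|u| = n`, `|v| = t`),
  `Pw` a little-endian numeral of the position `P = |p|`, `Df = ⟨D, pad⟩` the padded current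
  program, `cb ∈ {ε, [b]}` the constraint on row `P` (all pairs are `boolPair`, read back by the
  total projections `fstP`/`sndP`).
* `SearchStream.Rel = {⟨q, D'⟩ | |D'| ≤ W(|uv|) ∧ ⟨uv, D'⟩ good ∧ ⟨q, D'⟩ ∈ ALL}` with the width
  polynomial `W = 8 X² + 12 X` (`SearchStream.Wp`, at least the length bound of `stub_goodProg`'s
  completeness clause, `SearchStream.goodWidth_le`) and
  `ALL = {r | ∀ w, |w| ≤ |r| → ⟨r, w⟩ ∈ RowOK}`, where the row test `RowOK` says: if `|w| = |u|`
  then (`val w < val Pw →` the evaluator answers the same on `⟨w, D'⟩` and `⟨w, D⟩`) and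
  (`cb ≠ ε → val w = val Pw →` the evaluator answers `cb` on `⟨w, D'⟩`).
* `RowOK ∈ P` (`CircEval.evalFn_mem_FP`, `Brick.ltFn`, length tests, Boolean closure), so
  `ALL ∈ ∀ᵖ·P = co NP`, hence `ALL ∈ P` under the collapse (`co_P_holds`, `compl_mem_P_iff`), so
  `Rel ∈ P` (`SearchStream.Rel_mem_P`), and `exists_searchFn_of_NP_subset_P` yields the search
  function (`SearchStream.exists_searchFn`).

References: D. M. McKay, C. D. Murray, R. R. Williams, *Weak lower bounds on resource-bounded
compression imply strong separations of complexity classes*, STOC 2019, §4 (Algorithm 1) and §5;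
S. Arora, B. Barak, *Computational Complexity: A Modern Approach*, CUP 2009, Thm. 2.18, §1.3,
Def. 2.20 and Def. 5.3.
-/

namespace Summit.PneNP.PneNP.Cruxes.UniformMagnification.Birth

set_option linter.dupNamespace false -- `Summit.PneNP.PneNP.…`: summit = sub-problem (D-0017)

namespace SearchStream

open _root_.Computability
open Literature.Computability.Complexity Literature.Computability.MetaComplexity
open Literature.Computability.Complexity.CircEval Literature.Computability.Complexity.Brick
open Literature.Computability.Complexity.FortnowGrochowUP (mem_P_congr setOf_or_mem_P
  setOf_apply_mem_mem_P)
open Literature.Computability.Complexity.Kannan (setOf_and_mem_P setOf_imp_mem_P setOf_not_mem_P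
  setOf_length_le_mem_P setOf_length_eq_mem_P)

/-! ### Good programs and the width polynomial -/

/-- The good-program language of `stub_goodProg`: words `⟨⟨u, v⟩, D⟩` with `D` clean and
(`#TAB D ≤ |v| ≠ 0` or `D = rotCode k` with `k < |u|`). [cite: AroraBarakCC2009, Rem. 6.4] -/
def GoodL : Language Bool :=
  {w : List Bool | CircEval.isClean (sndP w) = true ∧
    (CircEval.tabCount (sndP w) ≤ (sndP (fstP w)).length ∧ (sndP (fstP w)).length ≠ 0 ∨
      ∃ k < (fstP (fstP w)).length, sndP w = CircEval.rotCode k)}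

/-- Reading `GoodL` on a pair `⟨⟨u, v⟩, D⟩`. [folklore] -/
theorem boolPair_mem_GoodL_iff (u v D : List Bool) :
    boolPair (boolPair u v) D ∈ GoodL ↔
      isClean D = true ∧ (tabCount D ≤ v.length ∧ v.length ≠ 0 ∨ ∃ k < u.length, D = rotCode k) := by
  show (_ ∧ _) ↔ _
  simp only [sndP_boolPair, fstP_boolPair]

/-- The width polynomial `W = 8 X² + 12 X`, evaluated at `m = |⟨u, v⟩| = 2 |u| + 2 + |v|`.
[folklore] -/
noncomputable def Wp : Polynomial ℕ := 8 * Polynomial.X ^ 2 + 12 * Polynomial.X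

/-- Value of the width polynomial. [folklore] -/
@[simp] theorem Wp_eval (m : ℕ) : Wp.eval m = 8 * m ^ 2 + 12 * m := by
  simp [Wp]

/-- The width polynomial is monotone. [folklore] -/
theorem Wp_mono {a b : ℕ} (h : a ≤ b) : Wp.eval a ≤ Wp.eval b := by
  rw [Wp_eval, Wp_eval]
  have := Nat.pow_le_pow_left h 2
  nlinarith

/-- The length bound `(t + 1) (8 (n + t) + 10) + 2 n` of the completeness clause of `stub_goodProg`
is below the width `W(|⟨u, v⟩|)` for `n = |u|`, `t = |v|`. [folklore] -/
theorem goodWidth_le (u v : List Bool) :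
    (v.length + 1) * (8 * (u.length + v.length) + 10) + 2 * u.length ≤
      Wp.eval (boolPair u v).length := by
  rw [Wp_eval, length_boolPair]
  nlinarith

/-! ### Reading the components of a pair `r = ⟨q, D'⟩`, `q = ⟨⟨uv, ⟨Pw, Df⟩⟩, cb⟩` -/

/-- `ssUv r = uv`. [folklore] -/
def ssUv : List Bool → List Bool := fstP ∘ fstP ∘ fstP
/-- `ssCb r = cb`. [folklore] -/
def ssCb : List Bool → List Bool := sndP ∘ fstP
/-- `ssPw r = Pw`. [folklore] -/
def ssPw : List Bool → List Bool := fstP ∘ sndP ∘ fstP ∘ fstP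
/-- `ssD r = D = fstP Df`. [folklore] -/
def ssD : List Bool → List Bool := fstP ∘ sndP ∘ sndP ∘ fstP ∘ fstP

/-- `ssUv ∈ FP`. [folklore] -/
theorem ssUv_mem_FP : ssUv ∈ FP := comp_mem_FP fstP_mem_FP (comp_mem_FP fstP_mem_FP fstP_mem_FP)
/-- `ssCb ∈ FP`. [folklore] -/
theorem ssCb_mem_FP : ssCb ∈ FP := comp_mem_FP sndP_mem_FP fstP_mem_FP
/-- `ssPw ∈ FP`. [folklore] -/
theorem ssPw_mem_FP : ssPw ∈ FP :=
  comp_mem_FP fstP_mem_FP (comp_mem_FP sndP_mem_FP (comp_mem_FP fstP_mem_FP fstP_mem_FP))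
/-- `ssD ∈ FP`. [folklore] -/
theorem ssD_mem_FP : ssD ∈ FP :=
  comp_mem_FP fstP_mem_FP (comp_mem_FP sndP_mem_FP (comp_mem_FP sndP_mem_FP
    (comp_mem_FP fstP_mem_FP fstP_mem_FP)))

section Apply

variable (uv Pw Df cb D' : List Bool)

/-- `ssUv` reads `uv`. [folklore] -/
@[simp] theorem ssUv_apply : ssUv (boolPair (boolPair (boolPair uv (boolPair Pw Df)) cb) D') = uv := by
  simp [ssUv]
/-- `ssCb` reads `cb`. [folklore] -/
@[simp] theorem ssCb_apply : ssCb (boolPair (boolPair (boolPair uv (boolPair Pw Df)) cb) D') = cb := by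
  simp [ssCb]
/-- `ssPw` reads `Pw`. [folklore] -/
@[simp] theorem ssPw_apply : ssPw (boolPair (boolPair (boolPair uv (boolPair Pw Df)) cb) D') = Pw := by
  simp [ssPw]
/-- `ssD` reads `fstP Df`. [folklore] -/
@[simp] theorem ssD_apply : ssD (boolPair (boolPair (boolPair uv (boolPair Pw Df)) cb) D') = fstP Df := by
  simp [ssD]

end Apply

/-! ### The row test, the universal block, the relation -/

/-- **The row test** on `z = ⟨r, w⟩`, `r = ⟨q, D'⟩`: if `|w| = |u|` then
(`val w < val Pw →` `D'` and `D` answer the same on input `w`) and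
(`cb ≠ ε → val w = val Pw →` `D'` answers `cb` on input `w`). [cite: MckayMurrayWilliams2019, §4 (Algorithm 1)] -/
def RowOK : Language Bool :=
  {z | (sndP z).length = (fstP (ssUv (fstP z))).length →
    (bitsToNat (sndP z) < bitsToNat (ssPw (fstP z)) →
        evalFn (boolPair (sndP z) (sndP (fstP z))) = evalFn (boolPair (sndP z) (ssD (fstP z)))) ∧
    (¬ ssCb (fstP z) = [] → bitsToNat (sndP z) = bitsToNat (ssPw (fstP z)) →
        evalFn (boolPair (sndP z) (sndP (fstP z))) = ssCb (fstP z))}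

/-- Reading the row test on `⟨r, w⟩`. [folklore] -/
theorem boolPair_mem_RowOK_iff (r w : List Bool) :
    boolPair r w ∈ RowOK ↔
      (w.length = (fstP (ssUv r)).length →
        (bitsToNat w < bitsToNat (ssPw r) → evalFn (boolPair w (sndP r)) = evalFn (boolPair w (ssD r))) ∧
        (¬ ssCb r = [] → bitsToNat w = bitsToNat (ssPw r) → evalFn (boolPair w (sndP r)) = ssCb r)) := by
  show (_ → _) ↔ _
  simp only [sndP_boolPair, fstP_boolPair]

/-- **The universal block** `ALL = {r | ∀ w, |w| ≤ |r| → ⟨r, w⟩ ∈ RowOK}` (all rows below the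
position agree with the old program, the row at the position is the new bit).
[cite: MckayMurrayWilliams2019, §4 (Algorithm 1)] -/
def ALL : Language Bool :=
  {r | ∀ w : List Bool, w.length ≤ (Polynomial.X : Polynomial ℕ).eval r.length → boolPair r w ∈ RowOK}

/-- **The consistency relation** `Rel = {r = ⟨q, D'⟩ | |D'| ≤ W(|uv|) ∧ ⟨uv, D'⟩ ∈ GoodL ∧ r ∈ ALL}`.
[cite: MckayMurrayWilliams2019, §4 (Algorithm 1)] -/
def Rel : Language Bool :=
  {r | (sndP r).length ≤ Wp.eval (ssUv r).length ∧ boolPair (ssUv r) (sndP r) ∈ GoodL ∧ r ∈ ALL}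

/-- Reading `Rel` on a well-formed pair `⟨⟨⟨uv, ⟨Pw, Df⟩⟩, cb⟩, D'⟩`. [folklore] -/
theorem boolPair_mem_Rel_iff (uv Pw Df cb D' : List Bool) :
    boolPair (boolPair (boolPair uv (boolPair Pw Df)) cb) D' ∈ Rel ↔
      D'.length ≤ Wp.eval uv.length ∧ boolPair uv D' ∈ GoodL ∧
      ∀ w : List Bool, w.length ≤ (boolPair (boolPair (boolPair uv (boolPair Pw Df)) cb) D').length →
        w.length = (fstP uv).length →
          (bitsToNat w < bitsToNat Pw → evalFn (boolPair w D') = evalFn (boolPair w (fstP Df))) ∧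
          (¬ cb = [] → bitsToNat w = bitsToNat Pw → evalFn (boolPair w D') = cb) := by
  show (_ ∧ _ ∧ ∀ w : List Bool, _ → boolPair _ w ∈ RowOK) ↔ _
  simp only [sndP_boolPair, ssUv_apply, Polynomial.eval_X, boolPair_mem_RowOK_iff, ssPw_apply,
    ssD_apply, ssCb_apply]

/-! ### `RowOK ∈ P` -/

section Atoms

variable {f g h : List Bool → List Bool}

/-- Atom: `val (f w) < val (g w)` (`Brick.ltFn`). [cite: AroraBarakCC2009, §1.3] -/
theorem atom_lt_mem_P (hf : f ∈ FP) (hg : g ∈ FP) :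
    ({w | bitsToNat (f w) < bitsToNat (g w)} : Language Bool) ∈ Classes.P :=
  mem_P_congr (setOf_apply_eq_apply_mem_P (comp_mem_FP ltFn_mem_FP (pairFn_mem_FP hf hg))
    (const_mem_FP [true])) fun w => by
      show bitsToNat (f w) < bitsToNat (g w) ↔ (ltFn ∘ pairFn f g) w = [true]
      simp

/-- Atom: `val (f w) = val (g w)` (two strict comparisons). [cite: AroraBarakCC2009, §1.3] -/
theorem atom_valEq_mem_P (hf : f ∈ FP) (hg : g ∈ FP) :
    ({w | bitsToNat (f w) = bitsToNat (g w)} : Language Bool) ∈ Classes.P :=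
  mem_P_congr (setOf_and_mem_P (setOf_not_mem_P (atom_lt_mem_P hf hg))
    (setOf_not_mem_P (atom_lt_mem_P hg hf))) fun w => by
      show bitsToNat (f w) = bitsToNat (g w) ↔
        ¬ bitsToNat (f w) < bitsToNat (g w) ∧ ¬ bitsToNat (g w) < bitsToNat (f w)
      omega

/-- Atom: `|g w| = |f w|`. [cite: AroraBarakCC2009, §1.3] -/
theorem atom_lenEq_mem_P (hf : f ∈ FP) (hg : g ∈ FP) :
    ({w | (g w).length = (f w).length} : Language Bool) ∈ Classes.P :=
  mem_P_congr (setOf_length_eq_mem_P hf hg Polynomial.X) fun w => by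
    show (g w).length = (f w).length ↔ (g w).length = (Polynomial.X : Polynomial ℕ).eval (f w).length
    rw [Polynomial.eval_X]

/-- Atom: the evaluator answers the same on `⟨f w, g w⟩` and `⟨f w, h w⟩`
(`CircEval.evalFn_mem_FP`). [cite: AroraBarakCC2009, Thm. 6.18 (proof)] -/
theorem atom_evalEq_mem_P (hf : f ∈ FP) (hg : g ∈ FP) (hh : h ∈ FP) :
    ({w | evalFn (boolPair (f w) (g w)) = evalFn (boolPair (f w) (h w))} : Language Bool) ∈ Classes.P :=
  mem_P_congr (setOf_apply_eq_apply_mem_P (comp_mem_FP evalFn_mem_FP (pairFn_mem_FP hf hg))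
    (comp_mem_FP evalFn_mem_FP (pairFn_mem_FP hf hh))) fun w => by
      show evalFn (boolPair (f w) (g w)) = evalFn (boolPair (f w) (h w)) ↔
        (evalFn ∘ pairFn f g) w = (evalFn ∘ pairFn f h) w
      simp only [Function.comp_apply, pairFn_apply]

/-- Atom: the evaluator answers `h w` on `⟨f w, g w⟩`. [cite: AroraBarakCC2009, Thm. 6.18 (proof)] -/
theorem atom_evalIs_mem_P (hf : f ∈ FP) (hg : g ∈ FP) (hh : h ∈ FP) :
    ({w | evalFn (boolPair (f w) (g w)) = h w} : Language Bool) ∈ Classes.P :=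
  mem_P_congr (setOf_apply_eq_apply_mem_P (comp_mem_FP evalFn_mem_FP (pairFn_mem_FP hf hg)) hh)
    fun w => by
      show evalFn (boolPair (f w) (g w)) = h w ↔ (evalFn ∘ pairFn f g) w = h w
      simp only [Function.comp_apply, pairFn_apply]

/-- Atom: `f w = ε`. [cite: AroraBarakCC2009, §1.3] -/
theorem atom_nil_mem_P (hf : f ∈ FP) : ({w | f w = []} : Language Bool) ∈ Classes.P :=
  setOf_apply_eq_apply_mem_P hf (const_mem_FP [])

end Atoms

/-- **The row test is polynomial time** (a Boolean combination of the atoms on projected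
components). [cite: AroraBarakCC2009, Thm. 6.18 and §1.3] -/
theorem RowOK_mem_P : RowOK ∈ Classes.P :=
  mem_P_congr
    (setOf_imp_mem_P
      (atom_lenEq_mem_P (f := fstP ∘ ssUv ∘ fstP) (g := sndP)
        (comp_mem_FP fstP_mem_FP (comp_mem_FP ssUv_mem_FP fstP_mem_FP)) sndP_mem_FP)
      (setOf_and_mem_P
        (setOf_imp_mem_P
          (atom_lt_mem_P (f := sndP) (g := ssPw ∘ fstP) sndP_mem_FP
            (comp_mem_FP ssPw_mem_FP fstP_mem_FP))
          (atom_evalEq_mem_P (f := sndP) (g := sndP ∘ fstP) (h := ssD ∘ fstP) sndP_mem_FP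
            (comp_mem_FP sndP_mem_FP fstP_mem_FP) (comp_mem_FP ssD_mem_FP fstP_mem_FP)))
        (setOf_imp_mem_P
          (setOf_not_mem_P (atom_nil_mem_P (f := ssCb ∘ fstP) (comp_mem_FP ssCb_mem_FP fstP_mem_FP)))
          (setOf_imp_mem_P
            (atom_valEq_mem_P (f := sndP) (g := ssPw ∘ fstP) sndP_mem_FP
              (comp_mem_FP ssPw_mem_FP fstP_mem_FP))
            (atom_evalIs_mem_P (f := sndP) (g := sndP ∘ fstP) (h := ssCb ∘ fstP) sndP_mem_FP
              (comp_mem_FP sndP_mem_FP fstP_mem_FP) (comp_mem_FP ssCb_mem_FP fstP_mem_FP))))))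
    fun _ => Iff.rfl

/-! ### The collapse: `ALL ∈ P` and `Rel ∈ P` under `NP ⊆ P` -/

/-- `ALL ∈ ∀ᵖ·P` (`polyForall P = coNP`): its matrix is `RowOK ∈ P` with witness bound `X`.
[cite: AroraBarakCC2009, Def. 2.20 and Def. 5.3] -/
theorem ALL_mem_polyForall : ALL ∈ polyForall Classes.P :=
  mem_polyForall_iff.2 ⟨RowOK, RowOK_mem_P, Polynomial.X, fun _ => Iff.rfl⟩

/-- Under `NP ⊆ P`, `∀ᵖ·P ⊆ P`: `polyForall P = co (polyExists (co P))`, `co P = P`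
(`co_P_holds`), `polyExists P = NP ⊆ P`, and `P` is closed under complement (`compl_mem_P_iff`).
[cite: AroraBarakCC2009, Thm. 5.4] -/
theorem polyForall_P_subset_P (hNP : Nondeterministic.NP ⊆ Classes.P) :
    polyForall Classes.P ⊆ Classes.P := by
  intro L hL
  have h1 : Lᶜ ∈ polyExists (co Classes.P) := hL
  have h2 : co Classes.P = Classes.P := co_P_holds
  rw [h2] at h1
  exact compl_mem_P_iff.1 (hNP h1)

/-- **`ALL ∈ P` under the collapse.** [cite: AroraBarakCC2009, Thm. 5.4] -/
theorem ALL_mem_P (hNP : Nondeterministic.NP ⊆ Classes.P) : ALL ∈ Classes.P :=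
  polyForall_P_subset_P hNP ALL_mem_polyForall

/-- **`Rel ∈ P` under the collapse**: the width test (`setOf_length_le_mem_P`), the good-program
test (`hgoodP` pulled back along `r ↦ ⟨uv, D'⟩`), and `ALL`. [cite: AroraBarakCC2009, Thm. 5.4 and §1.3] -/
theorem Rel_mem_P (hgoodP : GoodL ∈ Classes.P) (hNP : Nondeterministic.NP ⊆ Classes.P) :
    Rel ∈ Classes.P :=
  mem_P_congr
    (setOf_and_mem_P (setOf_length_le_mem_P ssUv_mem_FP sndP_mem_FP Wp)
      (setOf_and_mem_P (setOf_apply_mem_mem_P hgoodP (pairFn_mem_FP ssUv_mem_FP sndP_mem_FP))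
        (show ({r | r ∈ ALL} : Language Bool) ∈ Classes.P from ALL_mem_P hNP)))
    fun r => by
      show ((sndP r).length ≤ Wp.eval (ssUv r).length ∧ boolPair (ssUv r) (sndP r) ∈ GoodL ∧ r ∈ ALL) ↔
        ((sndP r).length ≤ Wp.eval (ssUv r).length ∧ pairFn ssUv sndP r ∈ GoodL ∧ r ∈ ALL)
      rw [pairFn_apply]

/-- **The search function of the relation** (Arora–Barak, Thm. 2.18, under `NP ⊆ P`): a
polynomial-time `g` with `|g q| ≤ W(|q|)` and `⟨q, g q⟩ ∈ Rel` whenever `q` has a solution of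
length `≤ W(|q|)`. [cite: AroraBarakCC2009, Thm. 2.18] -/
theorem exists_searchFn (hgoodP : GoodL ∈ Classes.P) (hNP : Nondeterministic.NP ⊆ Classes.P) :
    ∃ g ∈ FP, ∀ q : List Bool,
      (∃ y : List Bool, y.length ≤ Wp.eval q.length ∧ boolPair q y ∈ Rel) →
        (g q).length ≤ Wp.eval q.length ∧ boolPair q (g q) ∈ Rel :=
  exists_searchFn_of_NP_subset_P hNP (Rel_mem_P hgoodP hNP) Wp

/-- **The live test** `r ↦ [r ∈ Rel]` is polynomial time under the collapse
(`indicatorFn_mem_FP`). [cite: AroraBarakCC2009, Def. 1.13] -/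
theorem relIndicator_mem_FP (hgoodP : GoodL ∈ Classes.P) (hNP : Nondeterministic.NP ⊆ Classes.P) :
    (fun r => encodeBool (Rel.boolIndicator r)) ∈ FP :=
  indicatorFn_mem_FP (Rel_mem_P hgoodP hNP)

end SearchStream

end Summit.PneNP.PneNP.Cruxes.UniformMagnification.Birth
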